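import Summits.HodgeConjecture.HodgeConjecture.Theses.AnchorTransport
import Summits.HodgeConjecture.HodgeConjecture.Theorems.AnchorTransportVariationalHodgeReductions
import Summits.HodgeConjecture.HodgeConjecture.Theorems.AnchorTransportVariationalHodgeLefschetzRange
import Literature.AlgebraicGeometry.HodgeTheory.SemiregularityMapReal
import Literature.AlgebraicGeometry.HodgeTheory.ChernCharacterBetti
import Literature.AlgebraicGeometry.Modules.LinearOverBase
import Literature.AlgebraicGeometry.Modules.VectorBundleFiniteLocallyFree
import Literature.AlgebraicGeometry.ModuliOfSheaves.K3SheafModuli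
import HarnessLib

/-!
# Line `exact-reduced-dimension-transport` — crux `AnchorTransport.VariationalHodge` (stmt-HodgeConjecture-1076)

Skeleton of the line (crux-plan; RESHAPED by the line lead, cycle 1, 2026-08-16 — see
`## Lead's reshape` below): FIVE stub statements, of which `DominantFamilyTransport` is LANDED
(`Theorems.stub_dominantFamilyTransport`, p107389) and FOUR remain registered `stub_*` (the only
`sorry`s of this file),
and the kernel-checked, sorry-free composition

  `VariationalHodge_of : ChernCharacterOnBetti → ExactAnchorSupply → ExactAnchorDominates →
     DominantFamilyTransport → DominanceForm → AnchorTransport.VariationalHodge`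

which concludes the crux BY NAME through the landed reduction of the crux to smooth irreducible
AFFINE bases (`Theorems.variationalHodge_of_affine`, p-landed, sorry-free) and the landed extreme
degrees (`Theorems.variationalHodge_conclusion_zero`, `Theorems.variationalHodge_conclusion_of_lt`:
and top degree `Theorems.variationalHodge_conclusion_top`: the stubs are only asked for `0 < p < n`).

## Lead's reshape (cycle 1) — what changed w.r.t. the planner's skeleton and why

1. `ExactAnchorSupply` — the B-VALVE IS CLOSED. As planned, the side class `B` of
   `A'_p = c • A + B` was only required to be FIBREWISE algebraic. That leaves a costume valve:
   whenever the conclusion of the crux is already known for the datum (`A|_t` algebraic for all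
   `t`), `B := -c • A`, `A'_k := 0` (`k > 0`), `E₀ := 𝒪_{𝒳_s}` satisfies every clause classically
   (`𝒪` is simple on the geometrically integral fibre; a line bundle has `ker σ = 0` because
   `σ₀ = Tr` is an isomorphism on `Ext²(L,L)`, and `dim Pic = h¹(𝒪)` makes it exact), so the planned
   stub was `V`-implied (hence `HC`-implied) by a two-line argument modulo Picard facts — exactly
   the sandwich that killed line `Sketch`, and contradicting the card's selling point "refutable
   independently of HC". Now `B` must lie in the `ℂ`-span of `ch_p` of GLOBAL vector bundles on the
   total space `𝒳` (the card's own wording: "`ch_p(E₀) ≡ c·A|_s` modulo classes restricted from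
   `Alg(𝒳)`"; on a smooth total space `Alg(𝒳) ⊗ ℚ = ch(K⁰(𝒳)) ⊗ ℚ`). Fibrewise algebraicity of
   such a `B` is PROVED below from the structure fields (`map_ch`, `ch_mem_algebraicClasses`,
   `IsVectorBundle.pullback`), so the composition is unchanged in spirit; the valve `B := -c • A`
   now needs `A ∈ ch(K⁰(𝒳))_ℂ`, which is an honest certificate of the crux's conclusion, not a
   restatement of it.
2. `ExactAnchorSupply` / `ExactAnchorDominates` / `HasDominantBundleFamily` /
   `DominantFamilyTransport` — side conditions on `A'_k` and the `ch_k` identities are asked for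
   `0 < k` only (`ch₀ = rank` plays no role in obstruction theory and `p > 0` in the composition;
   this removes the artefact "the unit class is of type `(0,0)` on every fibre" from the supplier's
   burden), and `ExactAnchorSupply` is asked only for `0 < p < n` (landed extreme and top degrees).
3. `HasDominantBundleFamily` — the Chern-character identity is asked at EVERY complex point of the
   parameter scheme `T` (not at one `y₀`). The flat continuation along the possibly SINGULAR `T`
   ("two global classes on `𝒳 ×_S T` agreeing on one fibre agree on all fibres": `R^{2k}` locally
   constant on `T(ℂ)`, `T(ℂ)` connected for irreducible `T`, SGA1 XII 2.4) thereby moves from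
   stub 3 into stub 2, where it is one more paragraph of the same paper proof (the tree's
   `Theorems.complexBetti_map_fiberι_eq_of_eq` needs a SMOOTH base, which the hull component is
   not at `y₀`). Stub 3 becomes: Chevalley + Nullstellensatz lift + `ch_mem_algebraicClasses` —
   provable now.

IDEA (crux idea card `Ideas/exact-reduced-dimension-transport.md`, ideator 3, TRIAGE r1: pass ×3).
Replace INJECTIVITY of the semiregularity map (Bloch 1972 / Buchweitz–Flenner 2003 Thm 5.1 /
Pridham / Perry: the one general engine on this crux, which "general principles do not give,
except for divisors", Voisin) by an EQUALITY OF TWO INTEGERS AT ONE ANCHOR. For a vector bundle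
`E₀` on the anchor fibre `X₀ = 𝒳_s` whose full Chern character is, degree by degree, the
restriction of global classes `A'_k` that are Hodge on EVERY fibre (the hypothesis of `V`), the
obstructions of the relative deformation functor of `E₀` along `𝒳/S` are annihilated by the FULL
real semiregularity map `σ = (σ_q)_q : Ext²(E₀,E₀) → ∏_q H^{q+2}(X₀, Ω^q)` (BF §4–5; Pridham 2024
Rem. 2.25), so `ker σ` is a complete obstruction space over the regular base `Λ = 𝒪̂_{S,s}` and the
hull count gives `dim R_rel ≥ dim S + ext¹(E₀,E₀) − dim ker σ`. If the ABSOLUTE local moduli of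
`E₀` on `X₀` has dimension AT MOST `ext¹ − dim ker σ` ("exact reduced dimension": `≥` always holds),
then `dim R_rel ≥ dim S + dim R_abs`, which forces `Λ ↪ R_rel`: the algebraised universal family
(Artin) has a component DOMINATING `S` (Chevalley / upper semicontinuity of fibre dimension). Chern
classes of the bundles of that family are algebraic and are the flat continuations of the `A'_k`,
so `A'_p|_t = c·A|_t + B|_t` is algebraic over a dense open of `S`; the dominance form of `V`
(algebraicity locus = countable union of Zariski-closed sets + Baire) finishes. Exactness is
typed WITHOUT Hilbert schemes or hulls: "every affine irreducible algebraic family of vector bundles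
on `X₀` through `E₀` in which `[E₀]` is an ISOLATED isomorphism class has dimension
`≤ ext¹(E₀,E₀) − dim_ℂ ker σ`" (`IsExactAnchor`; for a SIMPLE `E₀` the algebraised universal
deformation is such a family of dimension `dim R_abs`, so the typed condition is equivalent to
`dim R_abs ≤ ext¹ − dim ker σ`). `Ext`, `σ` (`semiregularityMapReal`), the `ℂ`-structure on `Ext`
(`Modules.LinearOverBase` + Mathlib `Ext.Linear`), families of sheaves (`ModuliOfSheaves.familyFibre`)
and Chern characters (`ChernCharacterBetti`, a hypothesis structure: stub 0 constructs it) are the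
tree's REAL carriers — no posited object.

THE FIVE STUBS (statements are the defs `<Name> : Prop` below; `theorem stub_<name> : <Name>`):
* `ChernCharacterOnBetti` (construction, L; SHARED verbatim with line
  `Cruxes/HodgeSimilitudeAlgebraic/Lines/semiregular-twin-hecke-vhc.lean`, stub 1): an instance of
  `HodgeTheory.ChernCharacterBetti`.
* `ExactAnchorSupply` (THE BET, hardest; research-open GEOGRAPHY, meets crux `AnchorExistence`):
  every affine VHC datum `(f, A, s₀)` has, at SOME complex point `s`, a simple vector bundle `E₀`
  on `𝒳_s` with exact reduced dimension whose Chern character is the restriction of fibrewise-Hodge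
  global classes `A'_k`, `A'_p = c·A + B` (`c ≠ 0`, `B` fibrewise algebraic). NOT implied by the
  Hodge conjecture (unlike the crux): refutable by ONE datum with universal strict superabundance.
* `ExactAnchorDominates` (the mechanism; known mathematics — BF 2003 §4–5 / Pridham 2024 Rem. 2.25
  reduced obstructions, Schlessinger hull count over a regular base, Grothendieck existence + Artin
  algebraisation for simple sheaves on a proper family, Altman–Kleiman `Spl`, EGA IV 13.1 — XL to
  formalise): exact simple anchor ⇒ a dominant affine irreducible family of vector bundles on a
  base change of `𝒳/S` whose Chern character at one parameter point is the restriction of the `A'_k`.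
* `DominantFamilyTransport` (M, provable now after the reshape): such a family makes every `A'_k`,
  `k > 0`, algebraic on the fibres over a dense Zariski-open of `S` (Chevalley constructibility;
  Nullstellensatz lift of complex points; Chern classes of vector bundles on smooth projective
  varieties are algebraic).
* `DominanceForm` (M/L; LANDED for families projective in Hartshorne's sense modulo the named facts
  `charlesSchnell_algebraicityLocus_iUnion_closed` + `mumford_smoothCurve_through_two_points`:
  `Theorems.variationalHodge_dominance_of_open`): algebraic over a non-empty Zariski open ⇒ algebraic
  at every complex point.
GENERALITY. Every stub is stated for the crux's OWN families (`IsSmoothProjectiveFamily`: smooth +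
proper + projective fibres; total space not assumed quasi-projective) over smooth irreducible affine
bases — the exact generality `variationalHodge_of_affine` reduces the crux to. The standing
modelling remark of the prover seats / `Disproof.lean` (the decl is formally stronger than
Charles–Schnell Conj. 11.3.1 by relative projectivity, `Theorems.…QuasiProjective`) therefore bears on
`DominanceForm` and `ExactAnchorSupply` exactly as it bears on the crux; nothing is hidden in a
reduction stub.

DISPROOF USED (`Cruxes/VariationalHodge/Disproof.lean`, cdisprove cycle 1, READ):
`withoutAnchor_iff_hodgeConjecture` — the anchor carries all content: this line USES the anchor in
`ExactAnchorSupply` (its `∃ s₀` hypothesis is what lets the supplier build `E₀` from an algebraic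
class; without it the stub is HC-strength); `withoutBaseHyps_of_hodgeConjecture` — base hypotheses
are load-bearing for the MECHANISM only: `Smooth S` is used in `ExactAnchorDominates` (hull over a
REGULAR `Λ`, `Λ` a domain), `IrreducibleSpace S` in `ExactAnchorDominates`/`DominantFamilyTransport`/
`DominanceForm` (dominant = dense image; flat continuation); `sketchStub_of_hodgeConjecture` /
p96133 (dead line `Sketch`: its one stub was crux-equivalent and HC-implied) — none of the five stubs
here is implied by `HodgeConjecture` (stubs 2–4 carry NO Hodge hypothesis on the class they
conclude about, or conclude existence of a bundle family; stub 1 asserts exactness), so each is a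
genuine refutation target; no `Negative/` lemma exists for this crux (nothing to import).
-/

noncomputable section

-- every declaration of this problem lives in `Summit.HodgeConjecture.HodgeConjecture.…` (summit = sub-problem)
set_option linter.dupNamespace false

open CategoryTheory CategoryTheory.Abelian AlgebraicGeometry CategoryTheory.Limits MonoidalCategory
open Literature.AlgebraicGeometry Literature.AlgebraicGeometry.Motives
  Literature.AlgebraicGeometry.HodgeTheory Literature.AlgebraicGeometry.Modules
  Literature.AlgebraicGeometry.ModuliOfSheaves
open Summit.HodgeConjecture.HodgeConjecture.Theses.AnchorTransport
open Summit.HodgeConjecture.HodgeConjecture.Theorems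

namespace Summit.HodgeConjecture.HodgeConjecture.Cruxes.VariationalHodge.ExactReducedDimensionTransport

/-! ## Typed notions of the line (defs with bodies over existing declarations) -/

/-- **Exact reduced dimension of a vector bundle `E₀` on `X₀`** (the card's `d₀ = h⁰(N) − dim ker π₀`
in its sheaf avatar `dim_{[E₀]} M(X₀) = ext¹(E₀,E₀) − dim ker σ_{E₀}`, typed WITHOUT moduli spaces
or hulls, in the upper-bound form that the dominance argument uses — the lower bound
`dim ≥ ext¹ − dim ker σ` is Bloch/BF unobstructedness-mod-`ker σ` and is not needed): for every
algebraic family `ℱ` of vector bundles on `X₀` parametrised by an affine irreducible `ℂ`-scheme `T₀`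
locally of finite type, through `E₀` at a complex point `y₀` (`ℱ_{y₀} ≅ E₀`, fibres taken with
`ModuliOfSheaves.familyFibre`, i.e. pull-back along the slice `X₀ ≅ X₀ × {y} ⟶ X₀ × T₀`) at which the
isomorphism class of `E₀` is ISOLATED (no other complex point of a Zariski neighbourhood of `y₀`
carries a fibre isomorphic to `E₀`), one has
`dim T₀ + dim_ℂ ⟨ker σ_{E₀}⟩_ℂ ≤ dim_ℂ Ext¹(E₀, E₀)`,
where `σ_{E₀} = semiregularityMapReal hE₀ : Ext²(E₀,E₀) → ∏_q H^{q+2}(X₀, Ω^q)` is the tree's REAL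
Buchweitz–Flenner semiregularity map (all form degrees) and `Ext` carries the `ℂ`-structure of
`Modules.LinearOverBase` (Mathlib `Ext.Linear`). For a SIMPLE `E₀` the algebraised universal
deformation (Grothendieck existence + Artin; `T₀ → Spl_{X₀}` étale at `y₀`, Altman–Kleiman) is such a
family of dimension `dim R_abs`, and every such family has `dim T₀ ≤ dim R_abs` (fibre-dimension
inequality for `T₀ → Spl`), so the predicate says exactly `dim R_abs ≤ ext¹ − dim ker σ`.
Semiregular (`ker σ = 0`, `IsSemiregularReal`) ⇒ exact (then `R_abs` is smooth of dimension `ext¹`);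
unobstructed-but-not-semiregular anchors are NEVER exact (triage k2/k3 blind side).
[cite: BuchweitzFlenner2003, Def. 4.1 and Thm. 7.3] [cite: Pridham2024, Rem. 2.25] -/
def IsExactAnchor (X₀ : SchemeOver ℂ) (E₀ : X₀.left.Modules) (hE₀ : IsFiniteLocallyFree E₀) : Prop :=
  ∀ (T₀ : SchemeOver ℂ) (y₀ : ComplexPoints T₀) (ℱ : (X₀ ⊗ T₀).left.Modules),
    IsAffine T₀.left → IrreducibleSpace T₀.left → LocallyOfFiniteType T₀.hom →
    IsFiniteLocallyFree ℱ → Nonempty (familyFibre ℱ y₀ ≅ E₀) →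
    (∃ V : Set T₀.left, IsOpen V ∧ y₀.pt ∈ V ∧
      ∀ y : ComplexPoints T₀, y.pt ∈ V → Nonempty (familyFibre ℱ y ≅ E₀) → y = y₀) →
    ∃ d : ℕ, topologicalKrullDim T₀.left = d ∧
      d + Module.finrank ℂ
            (Submodule.span ℂ ((semiregularityMapReal.{1} hE₀).ker : Set (Ext.{1} E₀ E₀ 2))) ≤
        Module.finrank ℂ (Ext.{1} E₀ E₀ 1)

/-- **A dominant algebraic family of vector bundles on (a base change of) `𝒳/S` with Chern
character `A'` in positive degrees** (lead's reshape, cycle 1): an affine irreducible `ℂ`-scheme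
`T` locally of finite type, a DOMINANT `h : T ⟶ S` (dense image) and a finite locally free `ℰ` on
`𝒳 ×_S T` (`Motives.familyPullback f h`) such that at EVERY complex point `y ∈ T(ℂ)` and for every
`k > 0` the class `ch_k(ℰ|_{(𝒳 ×_S T)_y})` equals the restriction to that fibre of `pr_𝒳^* A'_k`.
(What `ExactAnchorDominates` produces — the identity at the anchor parameter `y₀`, `ℰ|_{y₀} ≅ E₀`,
spread over `T(ℂ)` by flat continuation inside that stub — and all that `DominantFamilyTransport`
consumes.) [folklore] -/
def HasDominantBundleFamily {𝒳 S : SchemeOver ℂ} (f : 𝒳 ⟶ S) (C : ChernCharacterBetti)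
    (A' : (k : ℕ) → complexBetti 𝒳 (2 * k)) : Prop :=
  ∃ (T : SchemeOver ℂ) (h : T ⟶ S) (ℰ : (familyPullback f h).left.Modules),
    IsAffine T.left ∧ IrreducibleSpace T.left ∧ LocallyOfFiniteType T.hom ∧
    Dense (Set.range h.left.base) ∧ IsFiniteLocallyFree ℰ ∧
    ∀ (y : ComplexPoints T) (k : ℕ), 0 < k →
      C.ch (fiberOver (familyPullback.snd f h) y)
        ((Scheme.Modules.pullback (fiberι (familyPullback.snd f h) y).left).obj ℰ) k =
      complexBetti.map (fiberι (familyPullback.snd f h) y) (2 * k)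
        (complexBetti.map (familyPullback.fst f h) (2 * k) (A' k))

/-- **The side classes admitted in `ExactAnchorSupply`**: the `ℂ`-span of the degree-`2p` Chern
characters of GLOBAL vector bundles on the total space `𝒳` ("classes restricted from `Alg(𝒳)`" of
the idea card; on a smooth `𝒳`, `Alg(𝒳)_ℚ = ch(K⁰(𝒳))_ℚ`, Fulton Ex. 15.2.16 (b)). Their
restrictions to every smooth projective fibre are algebraic (`map_fiberι_mem_algebraicClasses_of_mem_globalChernSpan`).
[cite: Fulton1998, Example 15.2.16 (b)] -/
def globalChernSpan (C : ChernCharacterBetti) (𝒳 : SchemeOver ℂ) (p : ℕ) :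
    Submodule ℂ (complexBetti 𝒳 (2 * p)) :=
  Submodule.span ℂ {c | ∃ G : 𝒳.left.Modules, IsVectorBundle G ∧ C.ch 𝒳 G p = c}

/-- Restrictions of classes in `globalChernSpan C 𝒳 p` to the fibres of a smooth projective family
are algebraic: `(ch_p G)|_{𝒳_t} = ch_p(G|_{𝒳_t})` (`map_ch`) is algebraic on the smooth projective
fibre (`ch_mem_algebraicClasses`, `IsVectorBundle.pullback`), and `algebraicClasses` is a
`ℂ`-submodule. [cite: Fulton1998, §15.1 (ii) and Prop. 19.1.2] -/
theorem map_fiberι_mem_algebraicClasses_of_mem_globalChernSpan {n : ℕ} {𝒳 S : SchemeOver ℂ}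
    {f : 𝒳 ⟶ S} (hf : IsSmoothProjectiveFamily f n) (C : ChernCharacterBetti) {p : ℕ}
    {B : complexBetti 𝒳 (2 * p)} (hB : B ∈ globalChernSpan C 𝒳 p) (t : ComplexPoints S) :
    complexBetti.map (fiberι f t) (2 * p) B ∈ algebraicClasses (fiberOver f t) p := by
  induction hB using Submodule.span_induction with
  | mem c hc =>
    obtain ⟨G, hG, rfl⟩ := hc
    rw [C.map_ch (fiberι f t) G hG p]
    exact C.ch_mem_algebraicClasses (hf.isSmoothProjective t) _ (hG.pullback _) p
  | zero => rw [map_zero]; exact Submodule.zero_mem _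
  | add x y _ _ hx hy => rw [map_add]; exact Submodule.add_mem _ hx hy
  | smul a x _ hx => rw [map_smul]; exact Submodule.smul_mem _ a hx

/-! ## The stub statements -/

/-- STUB 0 (construction, L). **A Chern character of algebraic vector bundles on the real carriers
exists**: an instance of the hypothesis structure `HodgeTheory.ChernCharacterBetti` (data
`chᵢ(E) ∈ H²ⁱ(X(ℂ); ℂ)` with additivity, functoriality, normalisation on trivial and line bundles,
rationality, and on smooth projective `X` algebraicity + span; Fulton Ex. 3.2.3, §15.1,
Ex. 15.2.16 (b), Prop. 19.1.2; Voisin I Thm. 11.23/11.32). The tree deliberately has no `Nonempty`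
fact: the instance is a CONSTRUCTION (splitting principle / projective bundles on `X(ℂ)`). SHARED
verbatim with stub 1 of line `Cruxes/HodgeSimilitudeAlgebraic/Lines/semiregular-twin-hecke-vhc`.
[cite: Fulton1998, Example 3.2.3 and §15.1] [cite: VoisinHodgeI2002, Thm. 11.23] -/
def ChernCharacterOnBetti : Prop :=
  Nonempty ChernCharacterBetti

/-- STUB 1 (THE BET — hardest; anchor GEOGRAPHY). **Exact anchors exist on every VHC datum.** For a
smooth projective family `f : 𝒳 ⟶ S` of relative dimension `n` over a smooth irreducible AFFINE
`ℂ`-scheme, a global class `A ∈ H²ᵖ(𝒳(ℂ); ℂ)` with fibrewise rational `(p,p)` restrictions,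
ALGEBRAIC at some `s₀` (the anchor hypothesis of the crux — used here and only here), and any Chern
character theory `C`: there are a complex point `s ∈ S(ℂ)` (e.g. `s₀`, or any point where `A|_s` can
be shown algebraic), global classes `A'_k ∈ H²ᵏ(𝒳(ℂ); ℂ)` (`k ∈ ℕ`) with `(k,k)` restrictions on
EVERY fibre, a scalar `c ≠ 0` and a global class `B` with ALGEBRAIC restrictions on every fibre such
that `A'_p = c • A + B` ("`ch_p(E₀) ≡ c·A|_s` modulo classes restricted from `Alg(𝒳)`", the card's side
condition; `A'_k`, `k ≠ p`, are the side classes, e.g. Chern characters of global bundles, cup powers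
of `A`), and a finite locally free, SIMPLE (`dim_ℂ End(E₀) = 1`) `E₀` on `𝒳_s` with
`ch_k(E₀) = A'_k|_{𝒳_s}` for all `k`, of EXACT REDUCED DIMENSION (`IsExactAnchor`).
Holds with a line bundle for `p = 1` whenever `A|_s` is (a multiple of) `c₁` of the restriction of a
global line bundle (semiregular line bundles are exact; `Pic` has dimension `h¹(𝒪)`), and for
`p = n` with a point-like bundle; the content is `2 ≤ p ≤ n − 2` (first arena `p = 2`, `n = 4`:
Serre-construction rank-2 bundles, stable bundles, linked / twisted avatars of a cycle, at ANY point
of the algebraicity locus). Lead's reshape (cycle 1): asked only for `0 < p < n`; side conditions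
only in degrees `k > 0`; and `B ∈ globalChernSpan C 𝒳 p` (Chern characters of GLOBAL bundles) instead
of "`B` fibrewise algebraic" — with the planned clause the stub was implied by the crux itself
(`B := -c • A`, `E₀ := 𝒪`; module docstring §Lead's reshape), i.e. NOT refutable independently of
HC; with the present clause its negation is again "universal strict superabundance" of every simple
representative of `c • A|_s + ch_p(K⁰(𝒳))|_s` at every complex point of one datum — a finite
computation per candidate (`ext¹`, the rank of `σ`, a local dimension), M2/Singular-class on Fermat /
Movasati–Villaflor data (triage: the plane-pair meeting in a line is a CI(1,1,2) calibration, not a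
test). Why it might fail: exact ≠ unobstructed — every unobstructed non-semiregular anchor fails
exactness, so honesty of `ker σ` must be argued per anchor class; and for the crux's merely PROPER
families global bundles on `𝒳` (the source of `B` and of the `A'_k`, `k ≠ p`) are a thin supply.
[cite: Bloch1972Semiregularity, Introduction] [cite: BuchweitzFlenner2003, §5 Thm. 5.1]
[cite: VoisinTorino1994, Lecture 3 §0] [cite: MovasatiVillaflor2018, §§7–8] -/
def ExactAnchorSupply : Prop :=
  ∀ ⦃n : ℕ⦄ ⦃𝒳 S : SchemeOver ℂ⦄ (f : 𝒳 ⟶ S), IsSmoothProjectiveFamily f n →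
    IrreducibleSpace S.left → IsAffine S.left → AlgebraicGeometry.Smooth S.hom →
    ∀ (C : ChernCharacterBetti) (p : ℕ), 0 < p → p < n → ∀ (A : complexBetti 𝒳 (2 * p)),
    (∀ s : ComplexPoints S, IsRationalClass (complexBetti.map (fiberι f s) (2 * p) A) ∧
      IsOfHodgeType n (fiberOver f s) (2 * p) p p (complexBetti.map (fiberι f s) (2 * p) A)) →
    (∃ s₀ : ComplexPoints S,
      complexBetti.map (fiberι f s₀) (2 * p) A ∈ algebraicClasses (fiberOver f s₀) p) →
    ∃ (s : ComplexPoints S) (A' : (k : ℕ) → complexBetti 𝒳 (2 * k)) (c : ℂ)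
      (B : complexBetti 𝒳 (2 * p)) (E₀ : (fiberOver f s).left.Modules)
      (hE₀ : IsFiniteLocallyFree E₀),
      (∀ (t : ComplexPoints S) (k : ℕ), 0 < k →
        IsOfHodgeType n (fiberOver f t) (2 * k) k k (complexBetti.map (fiberι f t) (2 * k) (A' k))) ∧
      c ≠ 0 ∧
      B ∈ globalChernSpan C 𝒳 p ∧
      A' p = c • A + B ∧
      Module.finrank ℂ (E₀ ⟶ E₀) = 1 ∧
      (∀ k : ℕ, 0 < k → C.ch (fiberOver f s) E₀ k = complexBetti.map (fiberι f s) (2 * k) (A' k)) ∧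
      IsExactAnchor (fiberOver f s) E₀ hE₀

/-- STUB 2 (the MECHANISM — "exact anchors transport"; known mathematics, XL to formalise). For a
smooth projective family `f : 𝒳 ⟶ S` (smooth, proper, projective fibres) over a smooth irreducible
affine `ℂ`-scheme, global classes `A'_k` with `(k,k)` restrictions on EVERY fibre, and a simple
finite locally free `E₀` on a fibre `𝒳_s` with `ch_k(E₀) = A'_k|_{𝒳_s}` (all `k`) of exact reduced
dimension: there is a DOMINANT family of vector bundles through it (`HasDominantBundleFamily`).
Proof on paper: (1) for the deformation functor `F` of `E₀` along `𝒳 ×_S −` on Artinian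
`Λ = 𝒪̂_{S,s}`-algebras, every obstruction lies in `ker σ ⊗ I`: `σ_q(ob)` is the obstruction to
keeping `ch_{q+1}` a HORIZONTAL section inside `F^{q+1}` (Buchweitz–Flenner §4 Prop. 4.2 / §5 proof of
Thm. 5.1; Pridham Rem. 2.25; Bloch for `σ_{p−1}`), and the horizontal extension of `ch_{q+1}(E₀)` is
the flat class `A'_{q+1}`, a section of the SUBBUNDLE `F^{q+1}ℋ` because it is of type `(q+1,q+1)`
at every closed point of the REDUCED base `S`; (2) hull count over the regular `Λ` (Schlessinger;
Fantechi–Manetti): `dim R_F ≥ dim S + ext¹(E₀,E₀) − dim ker σ`; (3) `E₀` simple ⇒ `F` and its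
absolute restriction `F₀` are prorepresentable, `R_{F₀} = R_F ⊗_Λ ℂ`, and `IsExactAnchor` applied to
the algebraised universal family of `F₀` (Grothendieck existence on the proper `X₀`, Artin 1969
Thm. 1.6; `T₀ → Spl_{X₀}` étale at `y₀`, Altman–Kleiman) gives `dim R_{F₀} ≤ ext¹ − dim ker σ`;
(4) hence `dim R_F ≥ dim Λ + dim R_F/𝔪_Λ R_F`, so equality holds and `Λ → R_F` is injective (`Λ` a
domain), i.e. some minimal prime of `R_F` lies over `0`; (5) algebraise the universal family over
`Λ` (Artin, `f` proper): `(T, y₀) → (S, s)` of finite type with `𝒪̂_{T,y₀} ≅ R_F`, a vector bundle `ℰ`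
on `𝒳 ×_S T` near `X₀ × {y₀}` with `ℰ_{y₀} ≅ E₀`; the component of `T` through `y₀` given by that
minimal prime maps its generic point to the generic point of `S` — DOMINANT; restrict to an affine
irreducible open through `y₀`; `ch_k(ℰ_{y₀}) = ch_k(E₀) = A'_k|_s` by `ch_congr` and the fibre
identification `(𝒳 ×_S T)_{y₀} ≅ 𝒳_s` (`Motives.fiberOverFamilyPullbackIso`, `ChernCharacterBetti.map_ch`).
Uses `Smooth S` (regular `Λ`, dimension count) and `IrreducibleSpace S` (dominance) — cf.
`Disproof.withoutBaseHyps_of_hodgeConjecture`. Lead's reshape (cycle 1): hypotheses in degrees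
`k > 0` only, and the conclusion asks the `ch` identity at EVERY complex point of `T` — step (6):
`ch_k(ℰ)` and `pr^* A'_k` are two global classes on the total space of the smooth proper family
`𝒳 ×_S T → T` over the irreducible `T`, equal on the fibre at `y₀`, hence on every fibre (`R^{2k}`
of a smooth proper morphism is a local system on `T(ℂ)`, which is connected: SGA1 XII Prop. 2.4 =
`Motives.ComplexPoints.isConnected_setOf_pt_mem_of_isIrreducible_holds`; no smoothness of `T` is
needed for this). Why it might fail AS TYPED: only through a mismatch between `IsExactAnchor` and
`dim R_{F₀}` (excluded for SIMPLE `E₀` by (3)).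
[cite: BuchweitzFlenner2003, §4 Prop. 4.2 and §5 (proof of Thm. 5.1)] [cite: Pridham2024, Rem. 2.25]
[cite: Artin1969AlgebraizationI, Thm. 1.6] [cite: EGAIV3, Thm. 13.1.3] [cite: SGA1, Exp. XII Prop. 2.4] -/
def ExactAnchorDominates : Prop :=
  ∀ ⦃n : ℕ⦄ ⦃𝒳 S : SchemeOver ℂ⦄ (f : 𝒳 ⟶ S), IsSmoothProjectiveFamily f n →
    IrreducibleSpace S.left → IsAffine S.left → AlgebraicGeometry.Smooth S.hom →
    ∀ (C : ChernCharacterBetti) (A' : (k : ℕ) → complexBetti 𝒳 (2 * k)),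
    (∀ (t : ComplexPoints S) (k : ℕ), 0 < k →
      IsOfHodgeType n (fiberOver f t) (2 * k) k k (complexBetti.map (fiberι f t) (2 * k) (A' k))) →
    ∀ (s : ComplexPoints S) (E₀ : (fiberOver f s).left.Modules) (hE₀ : IsFiniteLocallyFree E₀),
    Module.finrank ℂ (E₀ ⟶ E₀) = 1 →
    (∀ k : ℕ, 0 < k → C.ch (fiberOver f s) E₀ k = complexBetti.map (fiberι f s) (2 * k) (A' k)) →
    IsExactAnchor (fiberOver f s) E₀ hE₀ →
    HasDominantBundleFamily f C A'

/-- STUB 3 (M; provable now). **Chern classes along a dominant family of bundles make the classes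
`A'_k` algebraic over a dense open.** For a smooth projective family `f : 𝒳 ⟶ S` over a smooth
irreducible affine `ℂ`-scheme, a Chern character theory `C`, global classes `A'_k` and a dominant
family of vector bundles with Chern character `A'` in positive degrees (`HasDominantBundleFamily`):
there is a non-empty Zariski open `U ⊆ S` such that `A'_k|_{𝒳_t}` is an algebraic class for every
complex point `t` over `U` and every `k > 0`. Proof: `h : T ⟶ S` is of finite presentation (`T`
affine and locally of finite type over `ℂ`, `S` affine of finite type), so its image is
constructible (Chevalley, Mathlib `Scheme.Hom.isConstructible_image`); a dense constructible subset
of the irreducible `S` contains a non-empty open `U` (it is a finite union of `Uᵢ \ Vᵢ`, `Uᵢ, Vᵢ`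
open; the generic point lies in the closure of one of them, forcing `Vᵢ = ∅`); a complex point `t`
over `U` lifts to a complex point `y` of `T` (the fibre `h⁻¹(pt t)` is a non-empty closed subset of
the Jacobson space `T`, so contains a closed point, which underlies a complex point —
Nullstellensatz, `Motives.EsnaultLevineViehweg.exists_algPoints_pt_eq`; complex points with the same
underlying point coincide); `ch_k(ℰ|_y)` is algebraic on the smooth projective fibre
(`ChernCharacterBetti.ch_mem_algebraicClasses`, `IsFiniteLocallyFree.pullback`) and equals
`(pr^*A'_k)|_y` by hypothesis; move it to `𝒳_{h(y)} = 𝒳_t`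
(`Theorems.familyPullback_map_fiberι_mem_algebraicClasses_iff`). No Hodge hypothesis: NOT a
consequence of the Hodge conjecture. [cite: Fulton1998, Prop. 19.1.2]
[cite: EGAIV3, Thm. 1.8.4 (Chevalley)] -/
def DominantFamilyTransport : Prop :=
  ∀ ⦃n : ℕ⦄ ⦃𝒳 S : SchemeOver ℂ⦄ (f : 𝒳 ⟶ S), IsSmoothProjectiveFamily f n →
    IrreducibleSpace S.left → IsAffine S.left → AlgebraicGeometry.Smooth S.hom →
    ∀ (C : ChernCharacterBetti) (A' : (k : ℕ) → complexBetti 𝒳 (2 * k)),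
    HasDominantBundleFamily f C A' →
    ∃ U : Set S.left, IsOpen U ∧ U.Nonempty ∧
      ∀ t : ComplexPoints S, t.pt ∈ U → ∀ k : ℕ, 0 < k →
        complexBetti.map (fiberι f t) (2 * k) (A' k) ∈ algebraicClasses (fiberOver f t) k

/-- STUB 4 (M on paper; L in the tree, with a running programme). **The dominance form of the
variational Hodge statement**: for a smooth projective family `f : 𝒳 ⟶ S` over a smooth irreducible
affine `ℂ`-scheme and ANY global class `A ∈ H²ᵖ(𝒳(ℂ); ℂ)`, algebraicity of `A|_{𝒳_t}` at all complex
points over a non-empty Zariski open `U ⊆ S` implies algebraicity at EVERY complex point (the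
algebraicity locus is a countable union of complex points of Zariski-closed subsets, proper over `S`
— relative Hilbert schemes, limits of cycles along curves; a member with interior is everything).
LANDED for `f` projective in Hartshorne's sense granted the named facts
`charlesSchnell_algebraicityLocus_iUnion_closed` and `mumford_smoothCurve_through_two_points`
(`Theorems.variationalHodge_dominance_of_open`, this exact shape plus `hι`); the Charles–Schnell
fact has a six-file proof programme in `HodgeTheory/AlgebraicityLocus*`. What remains: the two facts,
and the crux's extra generality (proper `f` with projective fibres, total space not assumed
quasi-projective: Hilbert functor of a proper morphism as an algebraic space, Artin 1969, and the
valuative criterion) — the same modelling gap the prover seats recorded on the crux itself. No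
Hodge hypothesis: NOT a consequence of the Hodge conjecture.
[cite: CharlesSchnell2014Notes, Prop. 11.3.11 (proof)] [cite: VoisinHodgeII2003, §3.3.1 and §7.3.2]
[cite: MumfordAV1970, §6 Lemma] -/
def DominanceForm : Prop :=
  ∀ ⦃n : ℕ⦄ ⦃𝒳 S : SchemeOver ℂ⦄ (f : 𝒳 ⟶ S), IsSmoothProjectiveFamily f n →
    IrreducibleSpace S.left → IsAffine S.left → AlgebraicGeometry.Smooth S.hom →
    ∀ (p : ℕ) (A : complexBetti 𝒳 (2 * p)) (U : Set S.left), IsOpen U → U.Nonempty →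
    (∀ t : ComplexPoints S, t.pt ∈ U →
      complexBetti.map (fiberι f t) (2 * p) A ∈ algebraicClasses (fiberOver f t) p) →
    ∀ t : ComplexPoints S,
      complexBetti.map (fiberι f t) (2 * p) A ∈ algebraicClasses (fiberOver f t) p

/-! ## Registered stubs (the only `sorry`s of the line)

Each stub is spelled out EXPLICITLY over tree declarations only (no line-local `def`), so that a
worker's `Theorems/….lean` file can state `theorem stub_<name> : <this signature>` verbatim in
`namespace Summit.HodgeConjecture.HodgeConjecture.Theorems` (with the `open` lines of this file) and
the gate matches it against the registry mechanically. The typed notions `IsExactAnchor`,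
`HasDominantBundleFamily`, `globalChernSpan` and the five `def <Name> : Prop` above are their
DEFINITIONAL abbreviations (`<name>_of_stub` below are `:= stub_<name>` by `rfl`-unfolding). -/

/-- STUB 0 — `ChernCharacterOnBetti`, explicit. -/
theorem stub_chernCharacterOnBetti : Nonempty ChernCharacterBetti := by
  sorry

/-- STUB 1 — `ExactAnchorSupply`, explicit (`globalChernSpan` and `IsExactAnchor` unfolded). -/
theorem stub_exactAnchorSupply :
    ∀ ⦃n : ℕ⦄ ⦃𝒳 S : SchemeOver ℂ⦄ (f : 𝒳 ⟶ S), IsSmoothProjectiveFamily f n →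
      IrreducibleSpace S.left → IsAffine S.left → AlgebraicGeometry.Smooth S.hom →
      ∀ (C : ChernCharacterBetti) (p : ℕ), 0 < p → p < n → ∀ (A : complexBetti 𝒳 (2 * p)),
      (∀ s : ComplexPoints S, IsRationalClass (complexBetti.map (fiberι f s) (2 * p) A) ∧
        IsOfHodgeType n (fiberOver f s) (2 * p) p p (complexBetti.map (fiberι f s) (2 * p) A)) →
      (∃ s₀ : ComplexPoints S,
        complexBetti.map (fiberι f s₀) (2 * p) A ∈ algebraicClasses (fiberOver f s₀) p) →
      ∃ (s : ComplexPoints S) (A' : (k : ℕ) → complexBetti 𝒳 (2 * k)) (c : ℂ)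
        (B : complexBetti 𝒳 (2 * p)) (E₀ : (fiberOver f s).left.Modules)
        (hE₀ : IsFiniteLocallyFree E₀),
        (∀ (t : ComplexPoints S) (k : ℕ), 0 < k →
          IsOfHodgeType n (fiberOver f t) (2 * k) k k
            (complexBetti.map (fiberι f t) (2 * k) (A' k))) ∧
        c ≠ 0 ∧
        B ∈ Submodule.span ℂ {b | ∃ G : 𝒳.left.Modules, IsVectorBundle G ∧ C.ch 𝒳 G p = b} ∧
        A' p = c • A + B ∧
        Module.finrank ℂ (E₀ ⟶ E₀) = 1 ∧
        (∀ k : ℕ, 0 < k →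
          C.ch (fiberOver f s) E₀ k = complexBetti.map (fiberι f s) (2 * k) (A' k)) ∧
        (∀ (T₀ : SchemeOver ℂ) (y₀ : ComplexPoints T₀) (ℱ : (fiberOver f s ⊗ T₀).left.Modules),
          IsAffine T₀.left → IrreducibleSpace T₀.left → LocallyOfFiniteType T₀.hom →
          IsFiniteLocallyFree ℱ → Nonempty (familyFibre ℱ y₀ ≅ E₀) →
          (∃ V : Set T₀.left, IsOpen V ∧ y₀.pt ∈ V ∧
            ∀ y : ComplexPoints T₀, y.pt ∈ V → Nonempty (familyFibre ℱ y ≅ E₀) → y = y₀) →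
          ∃ d : ℕ, topologicalKrullDim T₀.left = d ∧
            d + Module.finrank ℂ
                  (Submodule.span ℂ
                    ((semiregularityMapReal.{1} hE₀).ker : Set (Ext.{1} E₀ E₀ 2))) ≤
              Module.finrank ℂ (Ext.{1} E₀ E₀ 1)) := by
  sorry

/-- STUB 2 — `ExactAnchorDominates`, explicit (`IsExactAnchor` and `HasDominantBundleFamily`
unfolded). -/
theorem stub_exactAnchorDominates :
    ∀ ⦃n : ℕ⦄ ⦃𝒳 S : SchemeOver ℂ⦄ (f : 𝒳 ⟶ S), IsSmoothProjectiveFamily f n →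
      IrreducibleSpace S.left → IsAffine S.left → AlgebraicGeometry.Smooth S.hom →
      ∀ (C : ChernCharacterBetti) (A' : (k : ℕ) → complexBetti 𝒳 (2 * k)),
      (∀ (t : ComplexPoints S) (k : ℕ), 0 < k →
        IsOfHodgeType n (fiberOver f t) (2 * k) k k (complexBetti.map (fiberι f t) (2 * k) (A' k))) →
      ∀ (s : ComplexPoints S) (E₀ : (fiberOver f s).left.Modules) (hE₀ : IsFiniteLocallyFree E₀),
      Module.finrank ℂ (E₀ ⟶ E₀) = 1 →
      (∀ k : ℕ, 0 < k → C.ch (fiberOver f s) E₀ k = complexBetti.map (fiberι f s) (2 * k) (A' k)) →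
      (∀ (T₀ : SchemeOver ℂ) (y₀ : ComplexPoints T₀) (ℱ : (fiberOver f s ⊗ T₀).left.Modules),
        IsAffine T₀.left → IrreducibleSpace T₀.left → LocallyOfFiniteType T₀.hom →
        IsFiniteLocallyFree ℱ → Nonempty (familyFibre ℱ y₀ ≅ E₀) →
        (∃ V : Set T₀.left, IsOpen V ∧ y₀.pt ∈ V ∧
          ∀ y : ComplexPoints T₀, y.pt ∈ V → Nonempty (familyFibre ℱ y ≅ E₀) → y = y₀) →
        ∃ d : ℕ, topologicalKrullDim T₀.left = d ∧
          d + Module.finrank ℂ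
                (Submodule.span ℂ
                  ((semiregularityMapReal.{1} hE₀).ker : Set (Ext.{1} E₀ E₀ 2))) ≤
            Module.finrank ℂ (Ext.{1} E₀ E₀ 1)) →
      ∃ (T : SchemeOver ℂ) (h : T ⟶ S) (ℰ : (familyPullback f h).left.Modules),
        IsAffine T.left ∧ IrreducibleSpace T.left ∧ LocallyOfFiniteType T.hom ∧
        Dense (Set.range h.left.base) ∧ IsFiniteLocallyFree ℰ ∧
        ∀ (y : ComplexPoints T) (k : ℕ), 0 < k →
          C.ch (fiberOver (familyPullback.snd f h) y)
            ((Scheme.Modules.pullback (fiberι (familyPullback.snd f h) y).left).obj ℰ) k =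
          complexBetti.map (fiberι (familyPullback.snd f h) y) (2 * k)
            (complexBetti.map (familyPullback.fst f h) (2 * k) (A' k)) := by
  sorry

/-- STUB 3 — `DominantFamilyTransport`, explicit (`HasDominantBundleFamily` unfolded). **LANDED** as
`Summit.HodgeConjecture.HodgeConjecture.Theorems.stub_dominantFamilyTransport` (p107389, accepted, file
`Theorems/AnchorTransportVariationalHodgeStubDominantFamilyTransport.lean`); this `sorry` is replaced by
that theorem in the lead's working copy and here as soon as the farm serves the new module (publication
of this workfile requires elaboration). -/
theorem stub_dominantFamilyTransport :
    ∀ ⦃n : ℕ⦄ ⦃𝒳 S : SchemeOver ℂ⦄ (f : 𝒳 ⟶ S), IsSmoothProjectiveFamily f n →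
      IrreducibleSpace S.left → IsAffine S.left → AlgebraicGeometry.Smooth S.hom →
      ∀ (C : ChernCharacterBetti) (A' : (k : ℕ) → complexBetti 𝒳 (2 * k)),
      (∃ (T : SchemeOver ℂ) (h : T ⟶ S) (ℰ : (familyPullback f h).left.Modules),
        IsAffine T.left ∧ IrreducibleSpace T.left ∧ LocallyOfFiniteType T.hom ∧
        Dense (Set.range h.left.base) ∧ IsFiniteLocallyFree ℰ ∧
        ∀ (y : ComplexPoints T) (k : ℕ), 0 < k →
          C.ch (fiberOver (familyPullback.snd f h) y)
            ((Scheme.Modules.pullback (fiberι (familyPullback.snd f h) y).left).obj ℰ) k =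
          complexBetti.map (fiberι (familyPullback.snd f h) y) (2 * k)
            (complexBetti.map (familyPullback.fst f h) (2 * k) (A' k))) →
      ∃ U : Set S.left, IsOpen U ∧ U.Nonempty ∧
        ∀ t : ComplexPoints S, t.pt ∈ U → ∀ k : ℕ, 0 < k →
          complexBetti.map (fiberι f t) (2 * k) (A' k) ∈ algebraicClasses (fiberOver f t) k := by
  sorry

/-- STUB 4 — `DominanceForm`, explicit. -/
theorem stub_dominanceForm :
    ∀ ⦃n : ℕ⦄ ⦃𝒳 S : SchemeOver ℂ⦄ (f : 𝒳 ⟶ S), IsSmoothProjectiveFamily f n →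
      IrreducibleSpace S.left → IsAffine S.left → AlgebraicGeometry.Smooth S.hom →
      ∀ (p : ℕ) (A : complexBetti 𝒳 (2 * p)) (U : Set S.left), IsOpen U → U.Nonempty →
      (∀ t : ComplexPoints S, t.pt ∈ U →
        complexBetti.map (fiberι f t) (2 * p) A ∈ algebraicClasses (fiberOver f t) p) →
      ∀ t : ComplexPoints S,
        complexBetti.map (fiberι f t) (2 * p) A ∈ algebraicClasses (fiberOver f t) p := by
  sorry

/-! ## The stubs ARE the typed statements (definitional unfolding) -/

/-- `stub_chernCharacterOnBetti` IS `ChernCharacterOnBetti`. -/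
theorem chernCharacterOnBetti_of_stub : ChernCharacterOnBetti := stub_chernCharacterOnBetti

/-- `stub_exactAnchorSupply` IS `ExactAnchorSupply`. -/
theorem exactAnchorSupply_of_stub : ExactAnchorSupply := stub_exactAnchorSupply

/-- `stub_exactAnchorDominates` IS `ExactAnchorDominates`. -/
theorem exactAnchorDominates_of_stub : ExactAnchorDominates := stub_exactAnchorDominates

/-- `DominantFamilyTransport` — LANDED (`Theorems.stub_dominantFamilyTransport`, p107389, wave 1 of the
lead's cycle 1): Chevalley constructibility of the image of `h`, a dense constructible subset of the
irreducible `S` contains a non-empty open, Nullstellensatz lift of complex points, and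
`ChernCharacterBetti.ch_mem_algebraicClasses` on the smooth projective fibre. -/
theorem dominantFamilyTransport_of_stub : DominantFamilyTransport := stub_dominantFamilyTransport

/-- `stub_dominanceForm` IS `DominanceForm`. -/
theorem dominanceForm_of_stub : DominanceForm := stub_dominanceForm

/-! ## The composition: the five stub statements imply the crux BY NAME (sorry-free) -/

/-- THE SKELETON THEOREM (kernel-checked, no `sorry`): the five stub STATEMENTS imply the crux
`AnchorTransport.VariationalHodge` by name. Reduce to smooth irreducible affine bases
(`variationalHodge_of_affine`, landed) and to `0 < p < n` (`variationalHodge_conclusion_zero`,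
`variationalHodge_conclusion_of_lt`, `variationalHodge_conclusion_top`, landed); on an affine datum take the exact anchor of stub 1 at
`s`, the dominant bundle family of stub 2, the dense open of algebraicity of all `A'_k` (`k > 0`) of
stub 3, spread `A'_p` to every complex point by stub 4, and recover `A|_t = c⁻¹ • (A'_p|_t − B|_t)`
in the `ℂ`-submodule `algebraicClasses`, `B|_t` being algebraic because `B` is a combination of Chern
characters of global bundles (`map_fiberι_mem_algebraicClasses_of_mem_globalChernSpan`). -/
theorem VariationalHodge_of :
    ChernCharacterOnBetti → ExactAnchorSupply → ExactAnchorDominates → DominantFamilyTransport →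
      DominanceForm → Summit.HodgeConjecture.HodgeConjecture.Theses.AnchorTransport.VariationalHodge := by
  intro hC hSupply hDom hTrans hClose
  obtain ⟨C⟩ := hC
  refine variationalHodge_of_affine ?_
  intro n 𝒳 S f hf hirr haff hsm p A hA hs₀ t
  -- the extreme degrees are landed: `p = 0` and `n < p`
  rcases Nat.eq_zero_or_pos p with rfl | hp
  · exact variationalHodge_conclusion_zero f A t
  rcases lt_trichotomy p n with hpn | rfl | hnp
  rotate_left
  · exact variationalHodge_conclusion_top f hf hp A t
  · exact variationalHodge_conclusion_of_lt f hf hnp A t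
  -- `0 < p < n`: exact anchor ⇒ dominant bundle family ⇒ algebraic over an open ⇒ everywhere
  obtain ⟨s, A', c, B, E₀, hE₀, hA', hc, hB, hApB, hsimple, hch, hexact⟩ :=
    hSupply f hf hirr haff hsm C p hp hpn A hA hs₀
  have hfam : HasDominantBundleFamily f C A' :=
    hDom f hf hirr haff hsm C A' hA' s E₀ hE₀ hsimple hch hexact
  obtain ⟨U, hU, hUne, halg⟩ := hTrans f hf hirr haff hsm C A' hfam
  have key : complexBetti.map (fiberι f t) (2 * p) (A' p) ∈ algebraicClasses (fiberOver f t) p :=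
    hClose f hf hirr haff hsm p (A' p) U hU hUne (fun u hu => halg u hu p hp) t
  rw [hApB, map_add, map_smul] at key
  have h1 : c • complexBetti.map (fiberι f t) (2 * p) A ∈ algebraicClasses (fiberOver f t) p := by
    have h := Submodule.sub_mem _ key
      (map_fiberι_mem_algebraicClasses_of_mem_globalChernSpan hf C hB t)
    rwa [add_sub_cancel_right] at h
  have h2 := Submodule.smul_mem (algebraicClasses (fiberOver f t) p) c⁻¹ h1
  rwa [smul_smul, inv_mul_cancel₀ hc, one_smul] at h2

/-- The crux, modulo exactly the four registered stubs still open (stub 3 is landed). STATUS after the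
lead's cycle 1: `stub_chernCharacterOnBetti` blocked (no `E ↦ E(ℂ)` functor to topological bundles;
algebraicity/span comparisons un-vendored), `stub_exactAnchorSupply` open (research: anchor geography),
`stub_exactAnchorDominates` blocked (BF 2003 Prop. 4.2 relative form, hulls, Artin algebraisation —
none in tree), `stub_dominanceForm` blocked (`charlesSchnell_algebraicityLocus_iUnion_closed` + the
proper-not-projective case; LANDED for quasi-projective total spaces granted the fact alone:
`Theorems.dominanceForm_of_isQuasiProjectiveOver`, p108415). -/
theorem VariationalHodge_of_stubs :
    Summit.HodgeConjecture.HodgeConjecture.Theses.AnchorTransport.VariationalHodge :=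
  VariationalHodge_of chernCharacterOnBetti_of_stub exactAnchorSupply_of_stub
    exactAnchorDominates_of_stub dominantFamilyTransport_of_stub dominanceForm_of_stub

end Summit.HodgeConjecture.HodgeConjecture.Cruxes.VariationalHodge.ExactReducedDimensionTransport

end
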